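import Literature.MathematicalPhysics.QuantumFieldTheory.Balaban1983to89.B9Thm313WholeHolderZ
import Literature.MathematicalPhysics.QuantumFieldTheory.Balaban1983to89.B9Thm313WholeProbe43RHolderCut

/-!
# `Balaban1983to89.B9Thm313WholeGGProbesMembers` — T. Bałaban, *Propagators for lattice gauge theories in a background field*, Commun. Math. Phys. **99** (1985)
# 389–434 [`Balaban1985BackgroundPropagators`], Theorem 3.13 p. 426 (row 21): the two (3.43) Hölder-probe members of 𝔊 — Φ^Y_β∘∇_U∘𝔊 and Φ^X_β∘𝔊∘∇\*_U — AT THE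
# G₁-MEMBER LINE (the probes and entries of the G₁-words are HYPOTHESES with free constants; the rest is the letter algebra of (3.152)–(3.153)); NO step
# `G₀(Δ′_π + Δ⁽²⁾_π)` on a raw sup class is consumed

[4] = T. Bałaban, *Propagators and renormalization transformations for lattice gauge theories. II*, Commun. Math. Phys. **96** (1984) 223–250 [`Balaban1984PropagatorsII`].
statement-level skeleton of published theorems with citation tags; proofs where landed; nothing here is a claim about the Yang–Mills mass gap.

THE PRINT.  Thm 3.13 p. 426 (*"𝔊 … satisfies (3.42)–(3.47)"* from (3.152), (3.153), Theorem 3.12 and the estimates for G′, R); (3.43) p. 398; Thm 3.12 p. 423 (the Hölder member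
of a product read off the probe of the first factor and the state size of the second).

WHY THIS FILE (cell `pub-ymgap`, node N06, bundle F7 rows 20–21, seat dag-n06-l g27; programme P-U8S step S5b).  The landed probe readers (ym-inputs-p04's
`B9Thm313WholeProbe43LCut.GG_probe43L_cut_of_letters`, `B9Thm313WholeProbe43RHolderCut.GG_probe43R_holderCut_of_letters`) derive the G₁-level probes INSIDE from the one-step
fields `Step.step1` (`hK`) and `StepH.pY1 ∕ pX1` (`hpY ∕ hpX`) on the raw sup classes — LOCATED-U8′ species.  Over the REGULAR state they come from
`B9Thm312WholeMembersRegular` (`hasMaj_left_rightS`, the state probe fields of `hstate2 ∕ hstate1`); so THIS FILE re-issues both readers CUT AT THE G₁-MEMBER LINE: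
* ★★ `GG_probe43L_of_members` — from `G₁ : 𝔠^{(0)} → 𝔠^{(−2)}` (A₁), `Φ^Y_β∇_UG₁ : 𝔠^{(0)} → 𝔠_P^{(β−1)}` (C_L), the product member `(Φ^Y_β∇_UG₀(Δ′_π+Δ⁽²⁾_π))∘(G₁D) :
  𝔠_W^{(−1)} → 𝔠_P^{(β−1)}` (A_T, ρ′+σ), `Φ^Y_β∇_UG₁Q\* : Z_w → 𝔠_P^{(β−1)}` (A_{DQ}, ρ′+σ), the probe letter `hpD` (Φ^Y_β∇_UG₀D out of the scalar Hölder class `bW`), `hrgdH`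
  (RD\*G₁ into `bW`) and the letters `rgd2 c1_2 q2`: constant `C_L + κ_W B_d B₃ c + A_T B₃ c + A_{DQ}(B₃(B₃A₁c)c)c`;
* ★★ `GG_probe43R_of_members` — from `G₁∇\*_U : 𝔠_Y^{(0)} → 𝔠^{(−1)}` (A₁), `Φ^X_βG₁∇\*_U : 𝔠_Y^{(0)} → 𝔠_P^{(β−1)}` (C_L), `Φ^X_βG₁Q\* : Z_{len·w} → 𝔠_P^{(β−1)}` (A_{DQ}, ρ′+σ), the
  letters `c1_1 q1`, the (3.152)-cut middle letters `gXH` (B_X) and `hWE` (Φ^X_β∘(D·G′·R·D\*) : bXH → 𝔠_P^{(β−1)}, B_{WE}): constant `C_L + κ_{XH}B_{WE}B_Xc + A_{DQ}(B₃(B₃A₁c)c)c`.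
HONEST SCOPE.  Letter algebra over hypothesis schemas of printed species; every analytic member is a HYPOTHESIS; nothing of [B9]∕[4] asserted; no pin, no certificate edit;
COUNT-NEUTRAL; N06 NOT discharged; nothing continuum ∕ OS positivity ∕ mass gap.  Cell `pub-ymgap` (HUMAN RULING D-0062), Track A node N06 [B9], seat `pub-ymgap-dag-n06-l` (g27),
2026-08-29.  NEW file; nothing landed is modified.
-/

namespace Literature.MathematicalPhysics.QuantumFieldTheory.Balaban1983to89.B9Thm313WholeGGProbesMembers

open Literature.MathematicalPhysics.QuantumFieldTheory.Balaban1983to89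
open Finset B6RandomWalk B6RandomWalkHom B9Thm34Ext B9Thm37GlueCor36 B11SectG B9SectDSup
open B9Thm37AllNorms B9Thm37AllNormsInstances B9Thm312Whole B9Thm312WholeLeaf B9Thm312WholeLeft B9Thm313Whole B9Thm313WholeLeft
open B9RWSums343Holder B9Ineq347 B9Thm312WholeClasses B9Thm312WholeHolder B9Thm312WholeHHolder B9Thm313WholeHolder
open B9Thm313WholeZ B9Thm313WholeLeftZ B9Thm313WholeHolderZ B9Thm313WholeRgdFrom3152 B9Thm313WholeProbe43RHolderCut

noncomputable section

section OneMember

variable {g : B9.Geometry} {B : B9.Backgrounds} {X Y Z W PX PY : Type}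
variable [Fintype X] [Fintype Y] [Fintype Z] [Fintype W] [Fintype PX] [Fintype PY] [Fintype g.Site]
variable {R₀ : ℝ} {H₀ : Prop}

/-! ## §1 The left (3.43) member Φ^Y_β∘∇_U∘𝔊 at the G₁-member line -/

omit [Fintype Y] [Fintype PX] in
/-- ★★ **THEOREM 3.13, THE LEFT (3.43) MEMBER OF 𝔊 AT THE G₁-MEMBER LINE** (`GG_probe43L_cut_of_letters` with the G₁-level members as HYPOTHESES — see the module docstring
for the list): Φ^Y_β∘∇_U∘𝔊 has the two-space majorant `(C_L + κ_W B_d B₃ c + A_T B₃ c + A_{DQ}(B₃(B₃A₁c)c)c)·(Lʲη)^{1−β}·e^{−ρ′d}` for every ρ′ ≧ 0 with ρ′ + 3σ ≦ ρ ≦ δ₃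
(TERM B split by the resolvent identity of (3.138): (Φ∇G₁D)(RD\*G₁) = (Φ∇G₀D)(RD\*G₁) + ((Φ∇G₀T)(G₁D))(RD\*G₁); TERM C through Z², Z_w; (3.153)).
[cite: Balaban1985BackgroundPropagators, Thm 3.13 p.426 + (3.152)–(3.153) p.426 + (3.138) p.423 + (3.43) p.398 + (3.49) p.399; Balaban1984PropagatorsII, (2.54) p.233 + Lemma 2.1 (2.61) p.234] -/
theorem GG_probe43L_of_members (hG : GeoOK g) {𝔬 : Ops g B X Y Z W} (𝔭 : HolderProbes g B X Y PX PY) {U : B.Cfg}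
    {bW : BlockNorm (toB6 g R₀ H₀) (W → ℝ)} {A₁ CL AT ADQ B₃ Bd β δ₃ ρ ρ' σ c : ℝ} (hrow : RowSum (toB6 g R₀ H₀) σ c) (hc : 0 ≤ c)
    (hA₁ : 0 ≤ A₁) (hCL : 0 ≤ CL) (hAT : 0 ≤ AT) (hADQ : 0 ≤ ADQ) (hB₃ : 0 ≤ B₃) (hBd : 0 ≤ Bd) (hσ : 0 ≤ σ) (hρ' : 0 ≤ ρ')
    (hρ'ρ : ρ' + 3 * σ ≤ ρ) (hρ₃ : ρ ≤ δ₃)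
    (hG1 : HasMaj (cNormR R₀ H₀ 𝔬.blk hG.lenle 0) (cNormR R₀ H₀ 𝔬.blk hG.lenle (-2)) (𝔬.G1 U ∘ₗ LinearMap.id)
      (fun a b => A₁ * Real.exp (-(ρ * g.dist a b))))
    (hD1 : HasMaj (cNormR R₀ H₀ 𝔬.blk hG.lenle 0) (cNormR R₀ H₀ 𝔭.blkPY hG.lenle (β - 1)) ((𝔭.ΦY U β ∘ₗ 𝔬.D U) ∘ₗ 𝔬.G1 U ∘ₗ LinearMap.id)
      (fun y y' => CL * Real.exp (-(ρ * g.dist y y'))))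
    (hGDT : HasMaj (cNormR R₀ H₀ 𝔬.blkW hG.lenle (-1)) (cNormR R₀ H₀ 𝔭.blkPY hG.lenle (β - 1))
      (((𝔭.ΦY U β ∘ₗ 𝔬.D U) ∘ₗ 𝔬.G0 U ∘ₗ (𝔬.Tpi U + 𝔬.T2 U)) ∘ₗ (𝔬.G1 U ∘ₗ 𝔬.Dv U))
      (fun y y' => AT * Real.exp (-((ρ' + σ) * g.dist y y'))))
    (wZ : g.Site → ℝ) (hwZ : ∀ y, 0 < wZ y)
    (hD1Q : HasMaj (weightNorm (BlockNorm.ofBlocks (toB6 g R₀ H₀) 𝔬.blkZ) wZ fun y => (hwZ y).le) (cNormR R₀ H₀ 𝔭.blkPY hG.lenle (β - 1))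
      ((𝔭.ΦY U β ∘ₗ 𝔬.D U) ∘ₗ 𝔬.G1 U ∘ₗ 𝔬.Qstar U) (fun y y' => ADQ * Real.exp (-((ρ' + σ) * g.dist y y'))))
    (hpD : HasMaj bW (cNormR R₀ H₀ 𝔭.blkPY hG.lenle (β - 1)) ((𝔭.ΦY U β ∘ₗ 𝔬.D U ∘ₗ 𝔬.G0 U) ∘ₗ 𝔬.Dv U)
      (fun a b => Bd * Real.exp (-(δ₃ * g.dist a b))))
    (hLrgd2 : HasMaj (cNorm R₀ H₀ 𝔬.blk hG.lenle 0) (cNorm R₀ H₀ 𝔬.blkW hG.lenle 1) (𝔬.R U ∘ₗ 𝔬.Dvstar U ∘ₗ 𝔬.G1 U ∘ₗ LinearMap.id)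
      (fun a b => B₃ * Real.exp (-(δ₃ * g.dist a b))))
    (hLc1_2 : HasMaj (cNorm R₀ H₀ 𝔬.blkZ hG.lenle 2) (weightNorm (BlockNorm.ofBlocks (toB6 g R₀ H₀) 𝔬.blkZ) wZ fun y => (hwZ y).le) (𝔬.C1 U)
      (fun a b => B₃ * Real.exp (-(δ₃ * g.dist a b))))
    (hLq2 : HasMaj (cNorm R₀ H₀ 𝔬.blk hG.lenle 2) (cNorm R₀ H₀ 𝔬.blkZ hG.lenle 2) (𝔬.Q U) (fun a b => B₃ * Real.exp (-(δ₃ * g.dist a b))))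
    (hrgdH : HasMaj (cNorm R₀ H₀ 𝔬.blk hG.lenle 0) bW
      (𝔬.R U ∘ₗ 𝔬.Dvstar U ∘ₗ 𝔬.G1 U ∘ₗ LinearMap.id) (fun a b => B₃ * Real.exp (-(δ₃ * g.dist a b))))
    (hI : Identities 𝔬 U) :
    HasMajorantHom (g := toB6 g R₀ H₀) 𝔬.blk 𝔭.blkPY (𝔭.ΦY U β ∘ₗ (𝔬.D U ∘ₗ 𝔬.GG U))
      (fun (a b : g.Site) => (CL + bW.κ * Bd * B₃ * c + AT * B₃ * c + ADQ * (B₃ * (B₃ * A₁ * c) * c) * c) *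
        g.len a ^ (1 - β) * Real.exp (-(ρ' * g.dist a b))) := by
  have hfix1 := fix_of_inverses hI.invG0' hI.invG1
  have htri : Triangle254 (toB6 g R₀ H₀) := fun a b c => hG.tri a b c
  set E : (X → ℝ) →ₗ[ℝ] (PY → ℝ) := 𝔭.ΦY U β ∘ₗ 𝔬.D U with hE
  set bout := cNormR R₀ H₀ 𝔭.blkPY hG.lenle (β - 1) with hbout
  -- (c) TERM B = (E G₁D)(RD*G₁) = (E G₀D)(RD*G₁) + ((E G₀T₁)(G₁D))(RD*G₁): the first summand through `bW`, the second through W^{(−1)}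
  have hρ'₃ : ρ' ≤ δ₃ := by linarith
  have hρ'σ₃ : ρ' + σ ≤ δ₃ := by linarith
  have hrgdH' : HasMaj (cNormR R₀ H₀ 𝔬.blk hG.lenle 0) bW (𝔬.R U ∘ₗ 𝔬.Dvstar U ∘ₗ 𝔬.G1 U ∘ₗ LinearMap.id)
      (fun a b => B₃ * Real.exp (-(δ₃ * g.dist a b))) := by
    have h := hasMaj_toR_src hG hrgdH
    simp only [Nat.cast_zero, neg_zero] at h
    exact h
  have hB1 : HasMaj (cNormR R₀ H₀ 𝔬.blk hG.lenle 0) bout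
      ((E ∘ₗ 𝔬.G0 U ∘ₗ 𝔬.Dv U) ∘ₗ (𝔬.R U ∘ₗ 𝔬.Dvstar U ∘ₗ 𝔬.G1 U ∘ₗ LinearMap.id))
      (fun y y' => bW.κ * Bd * B₃ * c * Real.exp (-(ρ' * g.dist y y'))) :=
    hasMaj_comp_exp htri hG.dnn hrow hBd hB₃ hρ' hρ'₃ hρ'σ₃ hpD hrgdH'
  have hLrgd2' : HasMaj (cNormR R₀ H₀ 𝔬.blk hG.lenle 0) (cNormR R₀ H₀ 𝔬.blkW hG.lenle (-1))
      (𝔬.R U ∘ₗ 𝔬.Dvstar U ∘ₗ 𝔬.G1 U ∘ₗ LinearMap.id) (fun a b => B₃ * Real.exp (-(δ₃ * g.dist a b))) := by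
    have h := hasMaj_toR hG hLrgd2
    simp only [Nat.cast_zero, neg_zero, Nat.cast_one] at h
    exact h
  have hB2 : HasMaj (cNormR R₀ H₀ 𝔬.blk hG.lenle 0) bout
      (((E ∘ₗ 𝔬.G0 U ∘ₗ (𝔬.Tpi U + 𝔬.T2 U)) ∘ₗ (𝔬.G1 U ∘ₗ 𝔬.Dv U)) ∘ₗ (𝔬.R U ∘ₗ 𝔬.Dvstar U ∘ₗ 𝔬.G1 U ∘ₗ LinearMap.id))
      (fun y y' => (cNormR R₀ H₀ 𝔬.blkW hG.lenle (-1) (X := W)).κ * AT * B₃ * c * Real.exp (-(ρ' * g.dist y y'))) :=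
    hasMaj_comp_exp htri hG.dnn hrow hAT hB₃ hρ' hρ'₃ le_rfl hGDT hLrgd2'
  simp only [cNormR_κ, one_mul] at hB2
  have eB : (E ∘ₗ 𝔬.G1 U ∘ₗ 𝔬.Dv U) ∘ₗ (𝔬.R U ∘ₗ 𝔬.Dvstar U ∘ₗ 𝔬.G1 U ∘ₗ LinearMap.id) =
      (E ∘ₗ 𝔬.G0 U ∘ₗ 𝔬.Dv U) ∘ₗ (𝔬.R U ∘ₗ 𝔬.Dvstar U ∘ₗ 𝔬.G1 U ∘ₗ LinearMap.id) +
        (((E ∘ₗ 𝔬.G0 U ∘ₗ (𝔬.Tpi U + 𝔬.T2 U)) ∘ₗ (𝔬.G1 U ∘ₗ 𝔬.Dv U)) ∘ₗ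
          (𝔬.R U ∘ₗ 𝔬.Dvstar U ∘ₗ 𝔬.G1 U ∘ₗ LinearMap.id)) := by
    rw [comp_fix_left_right E (𝔬.Dv U) hfix1, LinearMap.add_comp]
  have hB := hB1.add hB2
  rw [← eB] at hB
  -- (d) TERM C = (E G₁Q*)((QG₁Q*)⁻¹QG₁) through the classes Z², Z_{wZ} and the probe head `hpQ`
  have hQG : HasMaj (cNormR R₀ H₀ 𝔬.blk hG.lenle 0) (cNormR R₀ H₀ 𝔬.blkZ hG.lenle (-2)) (𝔬.Q U ∘ₗ (𝔬.G1 U ∘ₗ LinearMap.id))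
      (fun a b => (cNormR R₀ H₀ 𝔬.blk hG.lenle (-2) (X := X)).κ * B₃ * A₁ * c *
        Real.exp (-((ρ' + 2 * σ) * g.dist a b))) := by
    have hLq2' : HasMaj (cNormR R₀ H₀ 𝔬.blk hG.lenle (-2)) (cNormR R₀ H₀ 𝔬.blkZ hG.lenle (-2)) (𝔬.Q U)
        (fun a b => B₃ * Real.exp (-(δ₃ * g.dist a b))) := by
      have h := hasMaj_toR hG hLq2
      simp only [Nat.cast_ofNat] at h
      exact h
    exact hasMaj_comp_exp htri hG.dnn hrow hB₃ hA₁ (by linarith) (by linarith) (by linarith) hLq2' hG1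
  simp only [cNormR_κ, one_mul] at hQG
  have hK₁ : 0 ≤ B₃ * A₁ * c := mul_nonneg (mul_nonneg hB₃ hA₁) hc
  have hc12' : HasMaj (cNormR R₀ H₀ 𝔬.blkZ hG.lenle (-2)) (weightNorm (BlockNorm.ofBlocks (toB6 g R₀ H₀) 𝔬.blkZ) wZ fun y => (hwZ y).le) (𝔬.C1 U)
      (fun a b => B₃ * Real.exp (-(δ₃ * g.dist a b))) := by
    have h := hasMaj_toR_src hG hLc1_2
    simp only [Nat.cast_ofNat] at h
    exact h
  have hCQG : HasMaj (cNormR R₀ H₀ 𝔬.blk hG.lenle 0) (weightNorm (BlockNorm.ofBlocks (toB6 g R₀ H₀) 𝔬.blkZ) wZ fun y => (hwZ y).le)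
      (𝔬.C1 U ∘ₗ (𝔬.Q U ∘ₗ (𝔬.G1 U ∘ₗ LinearMap.id)))
      (fun a b => (cNormR R₀ H₀ 𝔬.blkZ hG.lenle (-2) (X := Z)).κ * B₃ * (B₃ * A₁ * c) * c *
        Real.exp (-((ρ' + σ) * g.dist a b))) :=
    hasMaj_comp_exp htri hG.dnn hrow hB₃ hK₁ (by linarith) (by linarith) (by linarith) hc12' hQG
  simp only [cNormR_κ, one_mul] at hCQG
  have hK₂ : 0 ≤ B₃ * (B₃ * A₁ * c) * c := mul_nonneg (mul_nonneg hB₃ hK₁) hc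
  have hC : HasMaj (cNormR R₀ H₀ 𝔬.blk hG.lenle 0) bout
      ((E ∘ₗ 𝔬.G1 U ∘ₗ 𝔬.Qstar U) ∘ₗ (𝔬.C1 U ∘ₗ (𝔬.Q U ∘ₗ (𝔬.G1 U ∘ₗ LinearMap.id))))
      (fun y y' => (weightNorm (BlockNorm.ofBlocks (toB6 g R₀ H₀) 𝔬.blkZ) wZ fun y => (hwZ y).le).κ *
        ADQ * (B₃ * (B₃ * A₁ * c) * c) * c * Real.exp (-(ρ' * g.dist y y'))) :=
    hasMaj_comp_exp htri hG.dnn hrow hADQ hK₂ hρ' (by linarith) le_rfl hD1Q hCQG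
  simp only [weightNorm_ofBlocks_κ, one_mul] at hC
  -- (e) assembling (3.153) with the left factor E
  have h := ((hD1.of_rate_le hG.dnn hCL (by linarith : ρ' ≤ ρ)).sub hB).sub hC
  rw [← E_GG_eq hI E] at h
  have hC0 : 0 ≤ CL + bW.κ * Bd * B₃ * c + AT * B₃ * c + ADQ * (B₃ * (B₃ * A₁ * c) * c) * c :=
    add_nonneg (add_nonneg (add_nonneg hCL (mul_nonneg (mul_nonneg (mul_nonneg bW.κ_nonneg hBd) hB₃) hc))
      (mul_nonneg (mul_nonneg hAT hB₃) hc)) (mul_nonneg (mul_nonneg hADQ hK₂) hc)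
  have h2 : HasMaj (cNormR R₀ H₀ 𝔬.blk hG.lenle 0) bout (E ∘ₗ 𝔬.GG U)
      (fun a b => (CL + bW.κ * Bd * B₃ * c + AT * B₃ * c + ADQ * (B₃ * (B₃ * A₁ * c) * c) * c) * Real.exp (-(ρ' * g.dist a b))) :=
    h.mono fun a b => le_of_eq (by simp only [toB6_dist]; ring)
  have h' := hasMajorantHom_of_hasMaj_cNormR hG (fun a b => mul_nonneg hC0 (Real.exp_nonneg _)) h2
  have h'' : HasMajorantHom (g := toB6 g R₀ H₀) 𝔬.blk 𝔭.blkPY (𝔭.ΦY U β ∘ₗ (𝔬.D U ∘ₗ 𝔬.GG U))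
      (fun (a b : g.Site) => (CL + bW.κ * Bd * B₃ * c + AT * B₃ * c + ADQ * (B₃ * (B₃ * A₁ * c) * c) * c) *
        Real.exp (-(ρ' * g.dist a b)) * g.len a ^ (-(β - 1)) * g.len b ^ (0 : ℝ)) := h'
  refine hasMajorantHom_mono (g := toB6 g R₀ H₀) 𝔬.blk 𝔭.blkPY h'' fun a b => le_of_eq ?_
  simp only [Real.rpow_zero, mul_one, show -(β - 1) = 1 - β by ring]
  ring

/-! ## §2 The right (3.43) member Φ^X_β∘𝔊∘∇\*_U at the G₁-member line, term B by (3.152) -/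

omit [Fintype PY] in
/-- ★★ **THEOREM 3.13, THE RIGHT (3.43) MEMBER OF 𝔊 AT THE G₁-MEMBER LINE** (`GG_probe43R_holderCut_of_letters` with the G₁-level members as HYPOTHESES): Φ^X_β∘𝔊∘∇\*_U has
the two-space majorant `(C_L + κ_{XH}B_{WE}B_Xc + A_{DQ}(B₃(B₃A₁c)c)c)·(Lʲη)^{1−β}·e^{−ρ′d}` for every ρ′ ≧ 0 with ρ′ + 3σ ≦ ρ ≦ δ₃ (term B through `bXH` by (3.152), term C
through Z¹, Z_{len·w}; (3.153)).
[cite: Balaban1985BackgroundPropagators, Thm 3.13 p.426 + (3.152)–(3.153) p.426 + (3.138) p.423 + (3.43)–(3.45) p.398; Balaban1984PropagatorsII, (2.52)–(2.56) pp.232–233 + Lemma 2.1 (2.61) p.234] -/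
theorem GG_probe43R_of_members (hG : GeoOK g) {𝔬 : Ops g B X Y Z W} (𝔭 : HolderProbes g B X Y PX PY) {U : B.Cfg}
    {Gp : B.Cfg → Module.End ℝ (W → ℝ)} {bXH : BlockNorm (toB6 g R₀ H₀) (X → ℝ)}
    {A₁ CL ADQ B₃ BX BWE β δ₃ ρ ρ' σ c : ℝ} (hrow : RowSum (toB6 g R₀ H₀) σ c) (hc : 0 ≤ c)
    (hA₁ : 0 ≤ A₁) (hCL : 0 ≤ CL) (hADQ : 0 ≤ ADQ) (hB₃ : 0 ≤ B₃) (hBX : 0 ≤ BX) (hBWE : 0 ≤ BWE)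
    (hσ : 0 ≤ σ) (hρ' : 0 ≤ ρ') (hρ'ρ : ρ' + 3 * σ ≤ ρ) (hρ₃ : ρ ≤ δ₃)
    (hG1 : HasMaj (cNormR R₀ H₀ 𝔬.blkY hG.lenle 0) (cNormR R₀ H₀ 𝔬.blk hG.lenle (-1)) (𝔬.G1 U ∘ₗ 𝔬.Dstar U)
      (fun a b => A₁ * Real.exp (-(ρ * g.dist a b))))
    (hD1 : HasMaj (cNormR R₀ H₀ 𝔬.blkY hG.lenle 0) (cNormR R₀ H₀ 𝔭.blkPX hG.lenle (β - 1)) (𝔭.ΦX U β ∘ₗ 𝔬.G1 U ∘ₗ 𝔬.Dstar U)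
      (fun y y' => CL * Real.exp (-(ρ * g.dist y y'))))
    {wZ : g.Site → ℝ} {hwZ : ∀ y, 0 < wZ y}
    (hD1Q : HasMaj (weightNorm (BlockNorm.ofBlocks (toB6 g R₀ H₀) 𝔬.blkZ) (fun y => g.len y * wZ y) fun y => (wZlen_pos hG hwZ y).le)
      (cNormR R₀ H₀ 𝔭.blkPX hG.lenle (β - 1)) (𝔭.ΦX U β ∘ₗ 𝔬.G1 U ∘ₗ 𝔬.Qstar U)
      (fun y y' => ADQ * Real.exp (-((ρ' + σ) * g.dist y y'))))
    (hc1_1 : HasMaj (cNorm R₀ H₀ 𝔬.blkZ hG.lenle 1)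
      (weightNorm (BlockNorm.ofBlocks (toB6 g R₀ H₀) 𝔬.blkZ) (fun y => g.len y * wZ y) fun y => (wZlen_pos hG hwZ y).le) (𝔬.C1 U)
      (fun a b => B₃ * Real.exp (-(δ₃ * g.dist a b))))
    (hq1 : HasMaj (cNorm R₀ H₀ 𝔬.blk hG.lenle 1) (cNorm R₀ H₀ 𝔬.blkZ hG.lenle 1) (𝔬.Q U)
      (fun a b => B₃ * Real.exp (-(δ₃ * g.dist a b))))
    (hXH : HasMaj (cNorm R₀ H₀ 𝔬.blkY hG.lenle 0) bXH (𝔬.G1 U ∘ₗ 𝔬.Dstar U)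
      (fun a b => BX * Real.exp (-(δ₃ * g.dist a b))))
    (hWE : HasMaj bXH (cNormR R₀ H₀ 𝔭.blkPX hG.lenle (β - 1)) (𝔭.ΦX U β ∘ₗ (𝔬.Dv U ∘ₗ Gp U ∘ₗ 𝔬.R U ∘ₗ 𝔬.Dvstar U))
      (fun a b => BWE * Real.exp (-(δ₃ * g.dist a b))))
    (hI : Identities 𝔬 U) (h152 : Ids3152 𝔬 Gp U) :
    HasMajorantHom (g := toB6 g R₀ H₀) 𝔬.blkY 𝔭.blkPX (𝔭.ΦX U β ∘ₗ (𝔬.GG U ∘ₗ 𝔬.Dstar U))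
      (fun (a b : g.Site) => (CL + bXH.κ * BWE * BX * c + ADQ * (B₃ * (B₃ * A₁ * c) * c) * c) *
        g.len a ^ (1 - β) * Real.exp (-(ρ' * g.dist a b))) := by
  -- adapted from `B9Thm313WholeHolderZ.GG_probe43R_of_lettersZ` (term B through `bXH` by (3.152) instead of through W⁰ by `rgd1`)
  have htri : Triangle254 (toB6 g R₀ H₀) := fun a b c => hG.tri a b c
  set E : (X → ℝ) →ₗ[ℝ] (PX → ℝ) := 𝔭.ΦX U β with hE
  set bout := cNormR R₀ H₀ 𝔭.blkPX hG.lenle (β - 1) with hbout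
  -- (c) TERM B = (E·D·G′·R·D*)∘(G₁∇*) through the free class `bXH` ((3.152), no letter `rgd1`)
  have hρ'₃ : ρ' ≤ δ₃ := by linarith
  have hXH' : HasMaj (cNormR R₀ H₀ 𝔬.blkY hG.lenle 0) bXH (𝔬.G1 U ∘ₗ 𝔬.Dstar U)
      (fun a b => BX * Real.exp (-(δ₃ * g.dist a b))) := by
    have h := hasMaj_toR_src hG hXH
    simp only [Nat.cast_zero, neg_zero] at h
    exact h
  have hB : HasMaj (cNormR R₀ H₀ 𝔬.blkY hG.lenle 0) bout
      ((E ∘ₗ (𝔬.Dv U ∘ₗ Gp U ∘ₗ 𝔬.R U ∘ₗ 𝔬.Dvstar U)) ∘ₗ (𝔬.G1 U ∘ₗ 𝔬.Dstar U))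
      (fun y y' => bXH.κ * BWE * BX * c * Real.exp (-(ρ' * g.dist y y'))) :=
    hasMaj_comp_exp htri hG.dnn hrow hBWE hBX hρ' hρ'₃ (by linarith) hWE hXH'
  -- (d) TERM C = (E G₁Q*)((QG₁Q*)⁻¹QG₁∇*) through Y⁰ → Z¹ → Z_{len·wZ}
  have hq1' : HasMaj (cNormR R₀ H₀ 𝔬.blk hG.lenle (-1)) (cNormR R₀ H₀ 𝔬.blkZ hG.lenle (-1)) (𝔬.Q U)
      (fun a b => B₃ * Real.exp (-(δ₃ * g.dist a b))) := by
    have h := hasMaj_toR hG hq1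
    simp only [Nat.cast_one] at h
    exact h
  have hQG : HasMaj (cNormR R₀ H₀ 𝔬.blkY hG.lenle 0) (cNormR R₀ H₀ 𝔬.blkZ hG.lenle (-1)) (𝔬.Q U ∘ₗ (𝔬.G1 U ∘ₗ 𝔬.Dstar U))
      (fun a b => (cNormR R₀ H₀ 𝔬.blk hG.lenle (-1) (X := X)).κ * B₃ * A₁ * c *
        Real.exp (-((ρ' + 2 * σ) * g.dist a b))) :=
    hasMaj_comp_exp htri hG.dnn hrow hB₃ hA₁ (by linarith) (by linarith) (by linarith) hq1' hG1
  simp only [cNormR_κ, one_mul] at hQG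
  have hK₁ : 0 ≤ B₃ * A₁ * c := mul_nonneg (mul_nonneg hB₃ hA₁) hc
  have hc11' : HasMaj (cNormR R₀ H₀ 𝔬.blkZ hG.lenle (-1)) (weightNorm (BlockNorm.ofBlocks (toB6 g R₀ H₀) 𝔬.blkZ) (fun y => g.len y * wZ y) fun y => (wZlen_pos hG hwZ y).le)
      (𝔬.C1 U) (fun a b => B₃ * Real.exp (-(δ₃ * g.dist a b))) := by
    have h := hasMaj_toR_src hG hc1_1
    simp only [Nat.cast_one] at h
    exact h
  have hCQG : HasMaj (cNormR R₀ H₀ 𝔬.blkY hG.lenle 0) (weightNorm (BlockNorm.ofBlocks (toB6 g R₀ H₀) 𝔬.blkZ) (fun y => g.len y * wZ y) fun y => (wZlen_pos hG hwZ y).le)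
      (𝔬.C1 U ∘ₗ (𝔬.Q U ∘ₗ (𝔬.G1 U ∘ₗ 𝔬.Dstar U)))
      (fun a b => (cNormR R₀ H₀ 𝔬.blkZ hG.lenle (-1) (X := Z)).κ * B₃ * (B₃ * A₁ * c) * c *
        Real.exp (-((ρ' + σ) * g.dist a b))) :=
    hasMaj_comp_exp htri hG.dnn hrow hB₃ hK₁ (by linarith) (by linarith) (by linarith) hc11' hQG
  simp only [cNormR_κ, one_mul] at hCQG
  have hK₂ : 0 ≤ B₃ * (B₃ * A₁ * c) * c := mul_nonneg (mul_nonneg hB₃ hK₁) hc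
  have hC : HasMaj (cNormR R₀ H₀ 𝔬.blkY hG.lenle 0) bout
      ((E ∘ₗ 𝔬.G1 U ∘ₗ 𝔬.Qstar U) ∘ₗ (𝔬.C1 U ∘ₗ (𝔬.Q U ∘ₗ (𝔬.G1 U ∘ₗ 𝔬.Dstar U))))
      (fun y y' => (weightNorm (BlockNorm.ofBlocks (toB6 g R₀ H₀) 𝔬.blkZ) (fun y => g.len y * wZ y) fun y => (wZlen_pos hG hwZ y).le).κ *
        ADQ * (B₃ * (B₃ * A₁ * c) * c) * c * Real.exp (-(ρ' * g.dist y y'))) :=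
    hasMaj_comp_exp htri hG.dnn hrow hADQ hK₂ hρ' (by linarith) le_rfl hD1Q hCQG
  simp only [weightNorm_ofBlocks_κ, one_mul] at hC
  -- (e) assembling (3.153) with E on the left and ∇* on the right, term B by (3.152)
  have h := ((hD1.of_rate_le hG.dnn hCL (by linarith : ρ' ≤ ρ)).sub hB).sub hC
  rw [← E_GG_F_eq_3152 hI h152 E (𝔬.Dstar U)] at h
  have hC0 : 0 ≤ CL + bXH.κ * BWE * BX * c + ADQ * (B₃ * (B₃ * A₁ * c) * c) * c :=
    add_nonneg (add_nonneg hCL (mul_nonneg (mul_nonneg (mul_nonneg bXH.κ_nonneg hBWE) hBX) hc)) (mul_nonneg (mul_nonneg hADQ hK₂) hc)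
  have h2 : HasMaj (cNormR R₀ H₀ 𝔬.blkY hG.lenle 0) bout (E ∘ₗ (𝔬.GG U ∘ₗ 𝔬.Dstar U))
      (fun a b => (CL + bXH.κ * BWE * BX * c + ADQ * (B₃ * (B₃ * A₁ * c) * c) * c) * Real.exp (-(ρ' * g.dist a b))) :=
    h.mono fun a b => le_of_eq (by simp only [toB6_dist]; ring)
  have h' := hasMajorantHom_of_hasMaj_cNormR hG (fun a b => mul_nonneg hC0 (Real.exp_nonneg _)) h2
  have h'' : HasMajorantHom (g := toB6 g R₀ H₀) 𝔬.blkY 𝔭.blkPX (𝔭.ΦX U β ∘ₗ (𝔬.GG U ∘ₗ 𝔬.Dstar U))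
      (fun (a b : g.Site) => (CL + bXH.κ * BWE * BX * c + ADQ * (B₃ * (B₃ * A₁ * c) * c) * c) *
        Real.exp (-(ρ' * g.dist a b)) * g.len a ^ (-(β - 1)) * g.len b ^ (0 : ℝ)) := h'
  refine hasMajorantHom_mono (g := toB6 g R₀ H₀) 𝔬.blkY 𝔭.blkPX h'' fun a b => le_of_eq ?_
  simp only [Real.rpow_zero, mul_one, show -(β - 1) = 1 - β by ring]
  ring

end OneMember

end

end Literature.MathematicalPhysics.QuantumFieldTheory.Balaban1983to89.B9Thm313WholeGGProbesMembers
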